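import Literature.GroupTheory.CombinatorialGroupTheory.PuncturedSurfaceGroupLoopTwistAt
import Literature.AnabelianGeometry.SemiGraphs.PSCSeparatingCoveringsIrreducibleNodalOneCuspEdges
import Literature.AnabelianGeometry.SemiGraphs.PSCIrreducibleMultiNodalOrigin
import HarnessLib

/-!
# [CombGC] Prop. 1.2, proof p. 9: EDGE-LIKE separating coverings at the UNPOINTED irreducible MULTI-nodal carrier (`k` loops, `2 ≤ k < g`)

Mochizuki, *A combinatorial version of the Grothendieck conjecture* [CombGC], PROOF of Prop. 1.2, p. 9, the
resp'd (edge) case [cite: MochizukiCombGC2007, Prop 1.2 proof p.9], typed LEVEL-WISE as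
`PSCDatum.EdgeLikeSeparatingCoverings` (row P12-L01-E; instance form of abc-iut FACT-LIST row F-2827), with the
edge-like cases of Prop. 1.2 (i)/(ii) via abc-iut-w5-d183's reductions.

PROOF-ONLY file (abc-iut-f-060 gen 9; row «NODE-RESIDUAL@UNMARKED», census stratum (7) of abc-iut-L3-lead δ11;
0 definitions).  The carrier: the unpointed irreducible `k`-nodal datum (`exists_irreducibleMultiNodalDatum Σ g 0 k`,
loops `cl ι⟨b_m⟩`, `m < k`, one vertex of genus `g − k ≥ 1`): distinct level nodes over the SAME loop are separated
by the LOOP TWIST AT `b_m` (`PuncturedSurfaceGroup.exists_levelHom_loopTwistAt`, cancelling handle `g − 1 ≥ k`),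
level nodes over DIFFERENT loops by the character `b_m ↦ 1` (abc-iut-f-164's `exists_open_separating_of_character`).

* `PuncturedSurfaceGroup.exists_normal_separating_loopTwistAt`, `IsProSigmaCompletion.loopTwistAt_exists_open_separating_sameNode`;
* `edgeLikeSeparatingCoverings_of_irreducibleMultiNodalClosed` — ★ F-2827 (`V' := V`) at EVERY such datum;
  `edgeRows_of_irreducibleMultiNodalClosed` — with Prop. 1.2 (i) edge-like and Prop. 1.2 (ii) for the loops
  (every loop node is COMMENSURABLY TERMINAL); `irreducibleMultiNodalClosedOrigin_edgeRows`,
  `exists_irreducibleMultiNodalClosedOrigin_edgeRows` — at every origin of such data, NON-VACUOUSLY.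

HONEST-OPEN here: F-2826 at this carrier (the vertex twist for the one vertex carrying `k ≥ 2` loops — abc-iut-w5-d183's
engine), hence F-2829/F-2830 and the verticial half of F-0438; `k = g` (rational normalisation).  Nothing here takes a
side on [IUTchIII] Cor. 3.12.
-/

noncomputable section

open Multiplicative

/-! ### The separating level of the loop twist at `b_m` (discrete packaging) -/

namespace Literature.GroupTheory.CombinatorialGroupTheory.PuncturedSurfaceGroup

open scoped Pointwise

variable {g r : ℕ}

/-- **Separating level for the `m`-th loop** ([CombGC] Prop. 1.2 proof p. 9, edge case, discrete form): `U ⊴ N` with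
`[N : U] ∣ |M|` missing an element of `f₁⟨b_m⟩f₁⁻¹ ∩ N` and containing `f₂⟨b_m⟩f₂⁻¹ ∩ N` whenever
`f₁⁻¹ f₂ ∉ ⟨b_m⟩·N`. [cite: MochizukiCombGC2007, Prop 1.2 proof p.9] -/
theorem exists_normal_separating_loopTwistAt {μ : ℕ} (hμ : μ + 1 < g)
    (N : Subgroup (PuncturedSurfaceGroup g r)) [hN : N.Normal] [N.FiniteIndex]
    {M : Type*} [Group M] [Finite M] {X Y Z : M} (hXYZ : X * Y * X⁻¹ * Y⁻¹ = Z)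
    (hZ : Z ∈ Subgroup.center M) (C : Subgroup M) (hCc : ∀ y ∈ C, ∀ y' ∈ C, y * y' = y' * y)
    (hXC : ∀ y ∈ C, X * y * X⁻¹ ∈ C) (hYC : Y ∈ C) {q : ℕ} (hZq : ∀ m : ℕ, Z ^ m = 1 ↔ q ∣ m)
    (hq : N.index ^ 3 < q) (f₁ : PuncturedSurfaceGroup g r) :
    ∃ U : Subgroup N, U.Normal ∧ U.index ∣ Nat.card M ∧ U.FiniteIndex ∧
      (∃ z ∈ (ConjAct.toConjAct f₁ • Subgroup.zpowers (b (r := r) (⟨μ, by omega⟩ : Fin g))) ⊓ N,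
        z ∉ U.map N.subtype) ∧
      ∀ f₂ : PuncturedSurfaceGroup g r,
        f₁⁻¹ * f₂ ∉ (Subgroup.zpowers (b (r := r) (⟨μ, by omega⟩ : Fin g)) : Set (PuncturedSurfaceGroup g r)) *
            (N : Set (PuncturedSurfaceGroup g r)) →
        (ConjAct.toConjAct f₂ • Subgroup.zpowers (b (r := r) (⟨μ, by omega⟩ : Fin g))) ⊓ N ≤ U.map N.subtype := by
  classical
  obtain ⟨ψ, halive, hkill⟩ := exists_levelHom_loopTwistAt hμ N hXYZ hZ C hCc hXC hYC hZq hq f₁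
  refine ⟨ψ.ker, inferInstance, ?_, ?_, ?_, ?_⟩
  · rw [Subgroup.index_ker]
    exact Subgroup.card_subgroup_dvd_card ψ.range
  · exact ⟨fun h0 => (Nat.card_pos (α := ψ.range)).ne' (by rwa [Subgroup.index_ker] at h0)⟩
  · refine ⟨f₁ * b ⟨μ, by omega⟩ ^ N.index * f₁⁻¹,
      Subgroup.mem_inf.mpr ⟨?_, hN.conj_mem _ (Subgroup.pow_index_mem N _) f₁⟩, fun hmem => ?_⟩
    · rw [Subgroup.mem_smul_pointwise_iff_exists]
      exact ⟨b ⟨μ, by omega⟩ ^ N.index, Subgroup.npow_mem_zpowers _ _, by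
        rw [ConjAct.smul_def, ConjAct.ofConjAct_toConjAct]⟩
    · obtain ⟨u, hu, hu'⟩ := Subgroup.mem_map.mp hmem
      refine halive ?_
      rw [← show u = ⟨f₁ * b ⟨μ, by omega⟩ ^ N.index * f₁⁻¹, hN.conj_mem _ (Subgroup.pow_index_mem N _) f₁⟩ from
        Subtype.ext hu']
      exact hu
  · intro f₂ hf₂ z hz
    exact Subgroup.mem_map.mpr ⟨⟨z, hz.2⟩, hkill f₂ hf₂ z hz, rfl⟩

end Literature.GroupTheory.CombinatorialGroupTheory.PuncturedSurfaceGroup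

namespace Literature.AnabelianGeometry.SemiGraphs

open scoped Pointwise
open Literature.AnabelianGeometry.Anabelioids (IsSigmaInteger)
open Literature.GroupTheory.CombinatorialGroupTheory
open Literature.GroupTheory.CombinatorialGroupTheory.PuncturedSurfaceGroup (a b c lift_relator
  exists_normal_separating_loopTwistAt)

/-! ### The same-loop separating covering, loop `b_m` -/

namespace SemiGraphOfAnabelioids.IsProSigmaCompletion

variable {Sigma : Set ℕ} {g r : ℕ} {P : Type*} [Group P] [TopologicalSpace P] [IsTopologicalGroup P]
  [CompactSpace P] [TotallyDisconnectedSpace P] {ι : PuncturedSurfaceGroup g r →* P}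

/-- **Same loop, loop `b_m`** (`m + 1 < g`): two DISTINCT level nodes `Vγ₁A ≠ Vγ₂A` over the loop with node group
`A = cl ι⟨b_m⟩` are separated by an open `U ≤ V`, normal in `V`. [cite: MochizukiCombGC2007, Prop 1.2 proof p.9] -/
theorem loopTwistAt_exists_open_separating_sameNode (hι : IsProSigmaCompletion Sigma ι) {μ : ℕ} (hμ : μ + 1 < g)
    {ℓ : ℕ} (hℓ : ℓ.Prime) (hℓS : ℓ ∈ Sigma)
    (A : Subgroup P) (hA : A = ((Subgroup.zpowers (b (r := r) (⟨μ, by omega⟩ : Fin g))).map ι).topologicalClosure)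
    (V : Subgroup P) [hVn : V.Normal] (hVo : IsOpen (V : Set P)) (γ₁ γ₂ : ConjAct P)
    (hne : DoubleCoset.doubleCoset (ConjAct.ofConjAct γ₁) (V : Set P) (A : Set P) ≠
      DoubleCoset.doubleCoset (ConjAct.ofConjAct γ₂) (V : Set P) (A : Set P)) :
    ∃ U : Subgroup P, IsOpen (U : Set P) ∧ U ≤ V ∧ (U.subgroupOf V).Normal ∧
      (γ₂ • A) ⊓ V ≤ U ∧ ¬ ((γ₁ • A) ⊓ V ≤ U) := by
  classical
  set x : PuncturedSurfaceGroup g r := b ⟨μ, by omega⟩ with hxdef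
  haveI hKfi : (V.comap ι).FiniteIndex := finiteIndex_comap hι V hVo
  set m : ℕ := (V.comap ι).index with hm
  set q : ℕ := ℓ ^ (m ^ 3) with hq
  have hmq : m ^ 3 < q := Nat.lt_pow_self hℓ.one_lt
  obtain ⟨φ, X, Y, Z, C, hXYZ, hZc, hZq, hcard, hCc, hXC, hYC⟩ := Heisenberg.exists_heisenbergTriple_inl q
  haveI : Finite (Multiplicative (ZMod q × ZMod q) ⋊[φ] Multiplicative (ZMod q)) :=
    Nat.finite_of_card_ne_zero (by rw [hcard]; exact pow_ne_zero _ (pow_ne_zero _ hℓ.ne_zero))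
  obtain ⟨f₁, w₁, hw₁, -, hA₁, hdc₁⟩ := exists_rep_unr hι A ⊥ V hVo γ₁
  obtain ⟨f₂, w₂, hw₂, -, hA₂, hdc₂⟩ := exists_rep_unr hι A ⊥ V hVo γ₂
  rw [sup_bot_eq] at hdc₁ hdc₂
  have hδ : f₁⁻¹ * f₂ ∉ (Subgroup.zpowers x : Set (PuncturedSurfaceGroup g r)) * (V.comap ι : Set _) := by
    intro hmem
    obtain ⟨a', ha', k, hk, hak⟩ := Set.mem_mul.mp hmem
    apply hne
    rw [hdc₁, hdc₂]
    symm
    have hkV : ι k ∈ V := hk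
    have haA : ι a' ∈ A := by rw [hA]; exact Subgroup.le_topologicalClosure _ (Subgroup.mem_map_of_mem ι ha')
    refine DoubleCoset.doubleCoset_eq_of_mem (DoubleCoset.mem_doubleCoset.mpr
      ⟨ι f₁ * ι a' * ι k * (ι f₁ * ι a')⁻¹, hVn.conj_mem _ hkV (ι f₁ * ι a'), ι a', haA, ?_⟩)
    have hf₂ : f₂ = f₁ * (a' * k) := by rw [hak, mul_inv_cancel_left]
    rw [hf₂, map_mul, map_mul]
    group
  obtain ⟨U', hU'n, hidx, hfi, halive, hkill⟩ :=
    exists_normal_separating_loopTwistAt hμ (V.comap ι) hXYZ hZc C hCc hXC hYC hZq (by rw [← hm]; exact hmq) f₁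
  haveI := hU'n
  have hU'S : IsSigmaInteger Sigma U'.index := by
    rw [hcard, hq, ← pow_mul] at hidx
    exact ⟨Nat.pos_of_ne_zero hfi.index_ne_zero, fun p hp hpd =>
      (isSigmaInteger_prime_pow hℓ hℓS _).2 p hp (hpd.trans hidx)⟩
  obtain ⟨U, hUo, hUV, hUn, hk, ha⟩ := exists_open_unrSeparating_of_discrete hι (Subgroup.zpowers x)
    (Subgroup.zpowers x) ⊥ V hVo f₁ f₂ U' hU'S (by rw [sup_bot_eq]; exact hkill f₂ hδ) halive
  haveI := hUn
  refine ⟨U, hUo, hUV, hUn, ?_, ?_⟩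
  · rw [hA₂, ← conjAct_smul_eq_of_subgroupOf_normal hUV hw₂, Subgroup.pointwise_smul_le_pointwise_smul_iff]
    exact le_trans (inf_le_inf_right V (by rw [hA]; exact le_sup_left)) hk
  · rw [hA₁, ← conjAct_smul_eq_of_subgroupOf_normal hUV hw₁, Subgroup.pointwise_smul_le_pointwise_smul_iff, hA]
    exact ha

end SemiGraphOfAnabelioids.IsProSigmaCompletion

/-! ### The character seeing one loop only -/

/-- A character `Γ_{g,r} → ℤ` with `b_{i₀} ↦ 1` and EVERY other generator `↦ 0`.
[cite: MochizukiSemiAnbd2006, Ex. 2.10 p.31] -/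
theorem PSCDatum.exists_character_b_only {g r : ℕ} (i₀ : Fin g) :
    ∃ Ψ : PuncturedSurfaceGroup g r →* Multiplicative ℤ, Ψ (b i₀) = ofAdd 1 ∧ (∀ i, i ≠ i₀ → Ψ (b i) = 1) ∧
      (∀ i, Ψ (a i) = 1) ∧ ∀ j, Ψ (c j) = 1 := by
  classical
  let f : puncturedSurfaceGen g r → Multiplicative ℤ :=
    Sum.elim (fun p => if p = (i₀, true) then ofAdd 1 else 1) fun _ => 1
  have hrel : ∀ R ∈ ({PuncturedSurfaceGroup.relator g r} : Set (FreeGroup (puncturedSurfaceGen g r))),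
      FreeGroup.lift f R = 1 := by
    intro R hR
    rw [Set.mem_singleton_iff] at hR
    rw [hR, lift_relator]
    have h1 : ((List.finRange g).map fun i => f (Sum.inl (i, false)) * f (Sum.inl (i, true)) *
        (f (Sum.inl (i, false)))⁻¹ * (f (Sum.inl (i, true)))⁻¹).prod = 1 :=
      List.prod_eq_one fun y hy => by
        obtain ⟨i, -, rfl⟩ := List.mem_map.mp hy
        rw [mul_inv_cancel_comm, mul_inv_cancel]
    have h2 : ((List.finRange r).map fun j => f (Sum.inr j)).prod = 1 :=
      List.prod_eq_one fun y hy => by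
        obtain ⟨j, -, rfl⟩ := List.mem_map.mp hy
        rfl
    rw [h1, h2, one_mul]
  refine ⟨PresentedGroup.toGroup hrel, ?_, fun i hi => ?_, fun i => ?_, fun j => ?_⟩
  · change PresentedGroup.toGroup hrel (PresentedGroup.of _) = _
    rw [PresentedGroup.toGroup.of]
    simp [f]
  · change PresentedGroup.toGroup hrel (PresentedGroup.of _) = _
    rw [PresentedGroup.toGroup.of]
    simp [f, hi]
  · change PresentedGroup.toGroup hrel (PresentedGroup.of _) = _
    rw [PresentedGroup.toGroup.of]
    simp [f]
  · change PresentedGroup.toGroup hrel (PresentedGroup.of _) = _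
    rw [PresentedGroup.toGroup.of]
    simp [f]

/-! ### The unpointed irreducible multi-nodal carrier -/

namespace PSCDatum

open SemiGraphOfAnabelioids (IsProSigmaCompletion)
open SemiGraphOfAnabelioids.IsProSigmaCompletion (loopTwistAt_exists_open_separating_sameNode
  exists_open_separating_of_character)

variable {P : Type} [Group P] [TopologicalSpace P] [IsTopologicalGroup P]
variable [CompactSpace P] [TotallyDisconnectedSpace P] {Sigma : Set ℕ} {g : ℕ}

/-- **Row F-2827 `EdgeLikeSeparatingCoverings` (`V' := V`) at EVERY unpointed irreducible `k`-nodal datum with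
`k < g`** (`Π` a pro-`Σ` completion of `Γ_{g,0}`, loops `cl ι⟨b_m⟩`, `m < k`): same loop by the loop twist at
`b_m` (cancelling handle `g − 1 ≥ k`), different loops by the character `b_m ↦ 1`.
[cite: MochizukiCombGC2007, Prop 1.2 proof p.9] -/
theorem edgeLikeSeparatingCoverings_of_irreducibleMultiNodalClosed (hne : Sigma.Nonempty)
    (hprime : ∀ p ∈ Sigma, p.Prime) (ι : PuncturedSurfaceGroup g 0 →* P)
    (hι : IsProSigmaCompletion Sigma ι) (G : PSCDatum P) {k : ℕ} (hk : k ≤ g) (hkg : k < g)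
    (e : G.graph.C ≃ Fin 0) (eN : G.graph.N ≃ Fin k)
    (hNg : ∀ m, G.nodeGp m = ((Subgroup.zpowers
      (PuncturedSurfaceGroup.b (r := 0) (Fin.castLE hk (eN m)))).map ι).topologicalClosure) :
    G.EdgeLikeSeparatingCoverings := by
  classical
  obtain ⟨ℓ, hℓS⟩ := hne
  have hℓ : ℓ.Prime := hprime ℓ hℓS
  have hNg' : ∀ m, G.nodeGp m = ((Subgroup.zpowers
      (PuncturedSurfaceGroup.b (r := 0) (⟨(eN m : ℕ), by have := (eN m).isLt; omega⟩ : Fin g))).map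
        ι).topologicalClosure := fun m => by rw [hNg m]; rfl
  intro V hVn hVo
  haveI := hVn
  refine ⟨V, hVn, hVo, le_rfl, fun e₁ e₂ γ₁ γ₂ hdist => ?_⟩
  rcases e₁ with n₁ | c₁
  · rcases e₂ with n₂ | c₂
    · by_cases hn : n₁ = n₂
      · -- same loop: the loop twist at `b_m`
        subst hn
        have hne' : DoubleCoset.doubleCoset (ConjAct.ofConjAct γ₁) (V : Set P) (G.nodeGp n₁ : Set P) ≠
            DoubleCoset.doubleCoset (ConjAct.ofConjAct γ₂) (V : Set P) (G.nodeGp n₁ : Set P) := by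
          rcases hdist with h | h
          · exact absurd rfl h
          · exact h
        exact loopTwistAt_exists_open_separating_sameNode hι (μ := (eN n₁ : ℕ))
          (by have := (eN n₁).isLt; omega) hℓ hℓS (G.nodeGp n₁) (hNg' n₁) V hVo γ₁ γ₂ hne'
      · -- different loops: the character `b_{m₁} ↦ 1`
        have hmm : Fin.castLE hk (eN n₁) ≠ Fin.castLE hk (eN n₂) := fun h =>
          hn (eN.injective (Fin.castLE_injective hk h))
        obtain ⟨Ψ, hΨ₁, hΨb, -, -⟩ := exists_character_b_only (g := g) (r := 0) (Fin.castLE hk (eN n₁))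
        have hΨ₂ : ∀ y ∈ Subgroup.zpowers (PuncturedSurfaceGroup.b (r := 0) (Fin.castLE hk (eN n₂))),
            Ψ y = 1 := by
          intro y hy
          obtain ⟨t, rfl⟩ := Subgroup.mem_zpowers_iff.mp hy
          rw [map_zpow, hΨb _ hmm.symm, one_zpow]
        have hb₁ : ι (PuncturedSurfaceGroup.b (r := 0) (Fin.castLE hk (eN n₁))) ∈ G.nodeGp n₁ := by
          rw [hNg n₁]
          exact Subgroup.le_topologicalClosure _ (Subgroup.mem_map_of_mem ι (Subgroup.mem_zpowers _))
        have hΨ₁' : Ψ (PuncturedSurfaceGroup.b (r := 0) (Fin.castLE hk (eN n₁))) ≠ 1 := by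
          rw [hΨ₁]; exact fun h => absurd (ofAdd_eq_one.mp h) one_ne_zero
        exact exists_open_separating_of_character hι hℓ hℓS Ψ (G.nodeGp n₂) _ (hNg n₂) hΨ₂ (G.nodeGp n₁) _ hb₁
          hΨ₁' V hVo γ₁ γ₂
    · exact (e c₂).elim0
  · exact (e c₁).elim0

/-- **F-2827 with its edge-like consequences at every unpointed irreducible `k`-nodal datum, `k < g`**: Prop. 1.2
(i) edge-like ("respectively, `e₁ = e₂`") and Prop. 1.2 (ii) for the edge-like subgroups — EVERY LOOP NODE
`γ cl ι⟨b_m⟩ γ⁻¹` IS COMMENSURABLY TERMINAL in `Π_G` (abc-iut-w5-d183's reductions).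
[cite: MochizukiCombGC2007, Prop 1.2(ii) p.8] -/
theorem edgeRows_of_irreducibleMultiNodalClosed (hne : Sigma.Nonempty)
    (hprime : ∀ p ∈ Sigma, p.Prime) (ι : PuncturedSurfaceGroup g 0 →* P)
    (hι : IsProSigmaCompletion Sigma ι) (G : PSCDatum P) {k : ℕ} (hk : k ≤ g) (hkg : k < g)
    (e : G.graph.C ≃ Fin 0) (eN : G.graph.N ≃ Fin k)
    (hNg : ∀ m, G.nodeGp m = ((Subgroup.zpowers
      (PuncturedSurfaceGroup.b (r := 0) (Fin.castLE hk (eN m)))).map ι).topologicalClosure) :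
    G.EdgeLikeSeparatingCoverings ∧ G.EdgeLikeOpenInterDeterminesEdge ∧
      ∀ (e' : G.graph.N ⊕ G.graph.C) (γ : ConjAct P),
        Subgroup.Commensurable.commensurator (γ • G.edgeGp e') = γ • G.edgeGp e' := by
  have hsep := G.edgeLikeSeparatingCoverings_of_irreducibleMultiNodalClosed hne hprime ι hι hk hkg e eN hNg
  exact ⟨hsep, G.edgeLikeOpenInterDeterminesEdge_of_separating hsep,
    fun e' γ => G.commensurator_edgeGp_eq_of_separating hsep e' γ⟩

/-! ### Origin level -/

/-- **F-2827 and its edge-like consequences at EVERY origin whose data are unpointed irreducible `k`-nodal data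
with `k < g`** (hypothesis shape of `exists_irreducibleMultiNodalDatum` at `r = 0`, profinite `Π` in `Type`).
[cite: MochizukiCombGC2007, Prop 1.2(ii) p.8] -/
theorem irreducibleMultiNodalClosedOrigin_edgeRows (Ω : PSCOrigin.{0})
    (hΩ : ∀ ⦃Q : Type⦄ [Group Q] [TopologicalSpace Q] [IsTopologicalGroup Q] (G : PSCDatum Q),
      Ω.IsOfPSCType G → CompactSpace Q ∧ TotallyDisconnectedSpace Q ∧
        ∃ (S : Set ℕ) (g k : ℕ) (hk : k ≤ g) (ι : PuncturedSurfaceGroup g 0 →* Q) (e : G.graph.C ≃ Fin 0)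
          (eN : G.graph.N ≃ Fin k),
          S.Nonempty ∧ (∀ p ∈ S, p.Prime) ∧ IsProSigmaCompletion S ι ∧ k < g ∧
          (∀ c, G.cuspGp c =
            ((PuncturedSurfaceGroup.cuspInertia (g := g) (e c)).map ι).topologicalClosure) ∧
          (∀ m, G.nodeGp m = ((Subgroup.zpowers
            (PuncturedSurfaceGroup.b (r := 0) (Fin.castLE hk (eN m)))).map ι).topologicalClosure)) :
    ∀ ⦃Q : Type⦄ [Group Q] [TopologicalSpace Q] [IsTopologicalGroup Q] (G : PSCDatum Q),
      Ω.IsOfPSCType G → G.EdgeLikeSeparatingCoverings ∧ G.EdgeLikeOpenInterDeterminesEdge ∧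
        ∀ (e' : G.graph.N ⊕ G.graph.C) (γ : ConjAct Q),
          Subgroup.Commensurable.commensurator (γ • G.edgeGp e') = γ • G.edgeGp e' := by
  intro Q _ _ _ G hG
  obtain ⟨hc, hd, S, g, k, hk, ι, e, eN, hne, hprime, hι, hkg, -, hNg⟩ := hΩ G hG
  haveI := hc
  haveI := hd
  exact G.edgeRows_of_irreducibleMultiNodalClosed hne hprime ι hι hk hkg e eN hNg

/-- **Non-vacuity: the origin of unpointed irreducible `k`-nodal data with `k < g` is INHABITED** (every nonempty
set `Σ` of primes, every `k ≤ g − 1`; inhabitant abc-iut-f-164's `exists_irreducibleMultiNodalDatum Σ g 0 k`) **and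
every datum of it carries F-2827 with its edge-like consequences** (loops commensurably terminal).
[cite: MochizukiCombGC2007, Prop 1.2(ii) p.8] -/
theorem exists_irreducibleMultiNodalClosedOrigin_edgeRows (Sigma : Set ℕ) (hne : Sigma.Nonempty)
    (hprime : ∀ p ∈ Sigma, p.Prime) {g k : ℕ} (hkg : k < g) :
    ∃ Ω : PSCOrigin.{0},
      (∃ (Q : ProfiniteGrp.{0}) (ι : PuncturedSurfaceGroup g 0 →* Q) (G : PSCDatum Q) (v₀ : G.graph.V),
        IsProSigmaCompletion Sigma ι ∧ Ω.IsOfPSCType G ∧ G.Sigma = Sigma ∧ G.graph.i = 1 ∧ G.graph.n = k ∧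
          G.graph.r = 0 ∧ (∀ w, w = v₀) ∧ G.genus v₀ = g - k) ∧
      ∀ ⦃Q : Type⦄ [Group Q] [TopologicalSpace Q] [IsTopologicalGroup Q] (G : PSCDatum Q),
        Ω.IsOfPSCType G → G.EdgeLikeSeparatingCoverings ∧ G.EdgeLikeOpenInterDeterminesEdge ∧
          ∀ (e' : G.graph.N ⊕ G.graph.C) (γ : ConjAct Q),
            Subgroup.Commensurable.commensurator (γ • G.edgeGp e') = γ • G.edgeGp e' := by
  classical
  have hk : k ≤ g := hkg.le
  let Ω : PSCOrigin.{0} :=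
    ⟨fun {Q} _ _ G => ∃ (_ : IsTopologicalGroup Q), CompactSpace Q ∧ TotallyDisconnectedSpace Q ∧
        ∃ (S : Set ℕ) (g k : ℕ) (hk : k ≤ g) (ι : PuncturedSurfaceGroup g 0 →* Q) (e : G.graph.C ≃ Fin 0)
          (eN : G.graph.N ≃ Fin k),
          S.Nonempty ∧ (∀ p ∈ S, p.Prime) ∧ IsProSigmaCompletion S ι ∧ k < g ∧
          (∀ c, G.cuspGp c =
            ((PuncturedSurfaceGroup.cuspInertia (g := g) (e c)).map ι).topologicalClosure) ∧
          (∀ m, G.nodeGp m = ((Subgroup.zpowers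
            (PuncturedSurfaceGroup.b (r := 0) (Fin.castLE hk (eN m)))).map ι).topologicalClosure)⟩
  refine ⟨Ω, ?_, irreducibleMultiNodalClosedOrigin_edgeRows Ω fun Q _ _ _ G hG => hG.2⟩
  obtain ⟨Q, ι, G, e, v₀, eN, hι, hS, hi, hn, hr, hC, hV, hNg, -, hgen, -⟩ :=
    exists_irreducibleMultiNodalDatum Sigma hne hprime g 0 k hk
  have hG : Ω.IsOfPSCType G := ⟨inferInstance, inferInstance, inferInstance, Sigma, g, k, hk, ι, e, eN, hne, hprime,
    hι, hkg, hC, hNg⟩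
  exact ⟨Q, ι, G, v₀, hι, hG, hS, hi, hn, hr, hV, hgen⟩

end PSCDatum

end Literature.AnabelianGeometry.SemiGraphs
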